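import Summits.ResolutionOfSingularities.ResolutionOfSingularities.Theorems.HilbertSamuelEliminationSigmaMaxModificationsCorridor3NearStep
import Summits.ResolutionOfSingularities.ResolutionOfSingularities.Theorems.HilbertSamuelEliminationSigmaMaxModificationsCorridor3RegularValue
import Summits.ResolutionOfSingularities.ResolutionOfSingularities.Theorems.HilbertSamuelEliminationCampaignW42OracleLocalOpens
import Literature.AlgebraicGeometry.Resolution.HilbertSamuelLocal
import HarnessLib

/-!
# [OURS · L1 W4.2] MAXIMAL ORIGINS ALONG `Reaches` AND ALONG OPEN IMMERSIONS; the POINTED RESTART DATA at an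
# isolated stage (crux `SigmaMaxModifications` stmt-ResolutionOfSingularities-18506, conjunct
# `SigmaMaxModificationsCorridor3` stmt-…-19249; line `w_ladder` v6; INPUT BRICKS for the W4.2 DEAL rows D7
# «ISO-TAIL EXTRACTION» (`IdeasL1Idea2R4.IsoTailTowerExtractionM`) and D8 «ISO-RESTART AT LOCAL ORACLES»
# (`IdeasL1Idea2R4.IsoOpenRestartM`))

Reserve prover res-type-071 (gen 19), after-care of the `ψ`-stability package (`…Corridor3PsiStable`, p509120/p509912).
Helper file `--supports stmt-ResolutionOfSingularities-19249`; kernel only (no named facts, no new definitions, no `sorry`).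

THE POINT. Every row functional of the line is quantified over MAXIMAL ORIGINS `IsMaximalOrigin p N ν X x` (`X` reduced,
separated, of finite type over a field of characteristic `p`, `dim X ≤ N`, `ν ∈ Σ_X^max`, `x` a closed point of `X(ν)`), and the
two tail rows of the W-top core RESTART the run: `IsoOpenRestartM` (…`Corridor3WLadderMovingIsoDefs` :206) concludes with a
POINTED maximal origin `(U, y)` — `IsMaximalOrigin p 3 ν U y ∧ QPointed 3 ν U y` — read off an open `U ∋ x_s` of a reached ISOLATED
stage `X_s` with `U ∩ X_s(ν) = {x_s}`, and `IsoTailTowerExtractionM` (:147) needs the base of the extracted tower, an open of a reached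
stage, to be «again a maximal origin for the same `ν`» (its docstring names «`IsMaximalOrigin` along `Reaches` and along open
immersions» as the only risk). This file supplies exactly that origin data, once:

* §1 `IsMaximalOrigin.of_reaches` — **EVERY STAGE REACHED FROM A MAXIMAL ORIGIN IS A MAXIMAL ORIGIN** for the same `(p, N, ν)` at
  its marked point (admissible oracle; BOTH at `ν ≠ Φ^{(N)}`, by the cycle invariant `IsMaximalOrigin.cycleInv_of_reaches`, and at the
  regular value `ν = Φ^{(N)}`, by `IsMaximalOrigin.regularValue_invariant`; separatedness over the ground field is carried through
  the proper blow-down maps; `dim ≤ N` by `Moving.dim_le_of_reaches`; the marked point is closed and in `X_n(ν)`).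
* §2 `IsMaximalOrigin.of_isOpenImmersion` — a maximal origin restricts to any open subscheme through the point
  (`Σ_U ⊆ Σ_W`, tree `Scheme.hsValues_subset_of_isOpenImmersion`; Noetherian / `dim` by `isNoetherian_of_isOpenImmersion`,
  `topologicalKrullDim_le_of_isOpenImmersion`); `qPointed_of_isOpenImmersion` — `U(ν) = {y}` when the image of `U` meets `W(ν)`
  in the point only (strata pull back, tree `Scheme.preimage_hsStratum_of_isOpenImmersion`).
* §3 at a maximal origin the `ν`-stratum lies in the Hilbert–Samuel locus, so ISOLATION in `W_max` (`IsIsolatedInHSMaxLocus`,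
  CJS Def. 13.3; the line's `Moving.Iso`) is isolation in `W(ν)`: an open `U ∋ w` with `U ∩ W(ν) = {w}`.
* §4 HEADLINES `IsMaximalOrigin.exists_opens_pointed_of_isIsolatedInHSMaxLocus` / `…_of_iso` / `exists_pointed_origin_of_iso`: at a
  stage `s` reached from a maximal origin with `Moving.Iso N s` there is an open `U ∋ x_s` of `X_s` such that `(U, x_s)` is a POINTED
  MAXIMAL ORIGIN: `IsMaximalOrigin p N ν U x_s ∧ QPointed N ν U x_s` (and `U ∩ X_s(ν) = {x_s}`, `U` locally Noetherian).
* §5 `IsMaximalOrigin.exists_isOpen_forall_hsFun_le` (upper semicontinuity at a point of a maximal stratum: `H^N ≤ ν` near it, so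
  `W_max = W(ν)` near it) and the transport of ISOLATION along open immersions: `isIsolatedInHSMaxLocus_of_isOpenImmersion_of_…`
  (ascent, any point of `W_max`), `IsMaximalOrigin.isIsolatedInHSMaxLocus_of_isOpenImmersion` (descent), `…_iff_…`, and the
  marked-stage forms `Moving.Iso.of_isOpenImmersion` / `.to_isOpenImmersion` / `Moving.iso_iff_of_isOpenImmersion` /
  `Moving.Iso.of_isOpenImmersion_of_reaches` (D8's brick: `Iso` is read on either side of the open immersions of a run-level
  Zariski localisation).

OURS bookkeeping over the tree's rendering of CJS Rem. 6.29 (1) / Def. 13.3; NOT a statement of the manuscript [Hironaka2017] nor of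
[CossartJannsenSaito2020]. AI-written; AI review is weaker than expert review.

## References
* V. Cossart, U. Jannsen, S. Saito, *Desingularization: Invariants and Strategy*, LNM 2270 (2020): Def. 2.28, Def. 2.35, Cor. 3.12,
  Rem. 6.29 (1), Def. 13.3. [CossartJannsenSaito2020]
* U. Görtz, T. Wedhorn, *Algebraic Geometry I* (2nd ed. 2020), Prop. 13.96 (1) (blow-ups are proper). [GortzWedhorn2020]
-/

noncomputable section

set_option linter.dupNamespace false -- mandated namespace of this single-conjunct summit

open CategoryTheory AlgebraicGeometry TopologicalSpace Topology

namespace Summit.ResolutionOfSingularities.ResolutionOfSingularities.Theorems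

namespace CampaignW42

open Literature.AlgebraicGeometry.Resolution Literature.RingTheory.HilbertSamuel
open Literature.AlgebraicGeometry.CossartJannsenSaito2020
open Summit.ResolutionOfSingularities.ResolutionOfSingularities.Theorems.SigmaMaxModificationsCorridor3
open Summit.ResolutionOfSingularities.ResolutionOfSingularities.Theorems.SigmaMaxModificationsCorridor3.Helpers (QPointed)

universe u

variable {p : ℕ} {R : ∀ S : Scheme.{u}, CentreSeq S → Prop} {N : ℕ} {ν : ℕ → ℕ}

/-! ## §1. Every reached stage is a maximal origin -/

/-- Separated finite type over a field propagates along a canonical near step (the blow-down map of a blow-up of a locally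
Noetherian scheme is proper). [cite: GortzWedhorn2020, Prop. 13.96 (1)] -/
theorem exists_overField_separated_of_canonicalNearStep {k : Type u} [Field k] {s s' : MarkedStage.{u}}
    (h : ∃ f : s.W ⟶ Spec (.of k), IsSeparated f ∧ LocallyOfFiniteType f ∧ QuasiCompact f)
    (hst : CanonicalNearStep R N ν s s') :
    ∃ f : s'.W ⟶ Spec (.of k), IsSeparated f ∧ LocallyOfFiniteType f ∧ QuasiCompact f := by
  obtain ⟨C, P', hln, x', -, -, -, -, rfl⟩ := hst
  obtain ⟨f, hf, hft, hq⟩ := h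
  haveI := s.ln
  haveI : IsProper (blowup.π C) := (blowup.isBlowup C).isProper
  exact ⟨blowup.π C ≫ f, inferInstance, inferInstance, inferInstance⟩

/-- … and along `Reaches`. [folklore] -/
theorem exists_overField_separated_of_reaches {k : Type u} [Field k] {s s' : MarkedStage.{u}}
    (h : ∃ f : s.W ⟶ Spec (.of k), IsSeparated f ∧ LocallyOfFiniteType f ∧ QuasiCompact f)
    (hr : Reaches R N ν s s') :
    ∃ f : s'.W ⟶ Spec (.of k), IsSeparated f ∧ LocallyOfFiniteType f ∧ QuasiCompact f := by
  induction hr with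
  | refl => exact h
  | tail _ hlast ih => exact exists_overField_separated_of_canonicalNearStep ih hlast

/-- If `ν` is never exceeded by `H^N_W` and is attained on `W`, it is a maximal value of `Σ_W`. [cite: CossartJannsenSaito2020, Def. 2.35] -/
theorem maximal_hsValues_of_supMax {W : Scheme.{u}} (hsup : ∀ w : W, ν ≤ Scheme.hsFun W N w → Scheme.hsFun W N w = ν)
    {w : W} (hw : w ∈ Scheme.hsStratum W N ν) : Maximal (· ∈ Scheme.hsValues W N) ν :=
  ⟨⟨w, Scheme.mem_hsStratum_iff.mp hw⟩, fun μ ⟨w', hw'⟩ hle => by subst hw'; exact (hsup w' hle).le⟩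

/-- **EVERY STAGE REACHED FROM A MAXIMAL ORIGIN IS A MAXIMAL ORIGIN** for the same prime `p`, level `N` and value `ν`, at its
marked point (admissible oracle): the stage is reduced, separated and of finite type over the ground field (proper blow-down maps),
of dimension `≤ N`; `ν` is still a MAXIMAL value of `H^N` of the stage (CJS Cor. 3.12 along the canonical sequence: `ν` is never
exceeded — cycle invariant at `ν ≠ Φ^{(N)}`, `H^N ≡ ν` at the regular value); the marked point is closed and lies in the
`ν`-stratum. [cite: CossartJannsenSaito2020, Cor. 3.12, Rem. 6.29 (1)] -/
theorem IsMaximalOrigin.of_reaches (hRa : OracleAdmissible R) {X : Scheme.{u}} [IsLocallyNoetherian X] {x : X}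
    (hX : IsMaximalOrigin p N ν X x) {s : MarkedStage.{u}} (hs : Reaches R N ν (MarkedStage.init X x) s) :
    IsMaximalOrigin p N ν s.W s.pt := by
  haveI : IsLocallyNoetherian s.W := s.ln
  obtain ⟨k, _, _, f, hsep, hft, hqc⟩ := hX.exists_structure
  have hstr := exists_overField_separated_of_reaches (k := k) (s := MarkedStage.init X x) ⟨f, hsep, hft, hqc⟩ hs
  have hpt : s.pt ∈ Scheme.hsStratum s.W N ν := Moving.pt_mem_hsStratum_of_reaches hX.mem_stratum hs
  have hcl : IsClosed ({s.pt} : Set s.W) := Reaches.isClosed_pt hX.isClosed hs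
  have hdim : topologicalKrullDim s.W ≤ (N : WithBot ℕ∞) :=
    Moving.dim_le_of_reaches (s₀ := MarkedStage.init X x) hs hX.dim_le
  have hrm : IsReduced s.W ∧ Maximal (· ∈ Scheme.hsValues s.W N) ν := by
    by_cases hν : ν = iterPSum N Phi
    · obtain ⟨hred, hH, -, -⟩ := hX.regularValue_invariant hRa hν hs
      exact ⟨hred, maximal_hsValues_of_supMax (fun w _ => hH w) hpt⟩
    · obtain ⟨k', _, _, -, hred, -, hsup, -, -⟩ := hX.cycleInv_of_reaches hRa hν hs
      exact ⟨hred, maximal_hsValues_of_supMax hsup hpt⟩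
  exact ⟨⟨k, ‹_›, ‹_›, hstr⟩, hrm.1, hdim, hrm.2, hcl, hpt⟩

/-- In-scope stages of the moving rows (`Moving.InScopeM`: reached from a maximal origin) ARE maximal origins. [folklore] -/
theorem _root_.Summit.ResolutionOfSingularities.ResolutionOfSingularities.Theorems.SigmaMaxModificationsCorridor3.Moving.InScopeM.isMaximalOrigin
    (hRa : OracleAdmissible R) {s : MarkedStage.{u}} (hs : Moving.InScopeM p R N ν s) : IsMaximalOrigin p N ν s.W s.pt := by
  obtain ⟨X, hX, x, horig, hreach⟩ := hs
  exact horig.of_reaches hRa hreach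

/-- `Reaches` from a reached stage, re-based: a stage reached from `s`, itself reached from a maximal origin `(X, x)`, is reached
from the maximal origin `(X, x)` (transitivity, for the record next to `of_reaches`). [folklore] -/
theorem IsMaximalOrigin.of_reaches_of_reaches (hRa : OracleAdmissible R) {X : Scheme.{u}} [IsLocallyNoetherian X] {x : X}
    (hX : IsMaximalOrigin p N ν X x) {s s' : MarkedStage.{u}} (hs : Reaches R N ν (MarkedStage.init X x) s)
    (hs' : Reaches R N ν s s') : IsMaximalOrigin p N ν s'.W s'.pt :=
  hX.of_reaches hRa (hs.trans hs')

/-! ## §2. Maximal origins restrict to open subschemes; pointedness on an isolating open -/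

/-- **A maximal origin restricts to every open subscheme through the point**: for an open immersion `j : U ⟶ W` and
`IsMaximalOrigin p N ν W (j y)`, also `IsMaximalOrigin p N ν U y` — `U` is reduced, separated and of finite type over the same
field, `dim U ≤ dim W ≤ N`, `H^N_U(y) = H^N_W(j y) = ν` (Hilbert–Samuel functions are local) and `ν` is maximal in
`Σ_U ⊆ Σ_W`. [cite: CossartJannsenSaito2020, Def. 2.28, Def. 2.35] -/
theorem IsMaximalOrigin.of_isOpenImmersion {U W : Scheme.{u}} [IsLocallyNoetherian W] (j : U ⟶ W) [IsOpenImmersion j]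
    {y : U} (hW : IsMaximalOrigin p N ν W (j.base y)) : IsMaximalOrigin p N ν U y := by
  obtain ⟨k, _, _, f, hsep, hft, hqc⟩ := hW.exists_structure
  haveI := hsep
  haveI := hft
  haveI := hqc
  haveI := hW.isReduced
  have hval : Scheme.hsFun U N y = ν := by
    rw [Scheme.hsFun_eq_of_isOpenImmersion j N y]
    exact hW.mem_stratum
  have hcl : IsClosed ({y} : Set U) := by
    have : ({y} : Set U) = j.base ⁻¹' {j.base y} := by
      ext z
      simp only [Set.mem_singleton_iff, Set.mem_preimage, j.isOpenEmbedding.injective.eq_iff]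
    rw [this]
    exact hW.isClosed.preimage j.continuous
  refine ⟨⟨k, ‹_›, ‹_›, j ≫ f, inferInstance, inferInstance, inferInstance⟩, isReduced_of_isOpenImmersion j,
    (topologicalKrullDim_le_of_isOpenImmersion j).trans hW.dim_le, ?_, hcl, hval⟩
  exact ⟨⟨y, hval⟩, fun μ hμ hle => hW.maximal.2 (Scheme.hsValues_subset_of_isOpenImmersion j N hμ) hle⟩

/-- **Pointedness on an isolating open**: if the image of the open immersion `j : U ⟶ W` meets `W(ν)` exactly in `j y`, then
`U(ν) = {y}` (`QPointed N ν U y`; strata pull back along open immersions). [cite: CossartJannsenSaito2020, Def. 2.28 (4)] -/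
theorem qPointed_of_isOpenImmersion {U W : Scheme.{u}} [IsLocallyNoetherian W] (j : U ⟶ W) [IsOpenImmersion j] {y : U}
    (h : Set.range j.base ∩ Scheme.hsStratum W N ν = {j.base y}) : QPointed N ν U y := by
  show Scheme.hsStratum U N ν = {y}
  rw [← Scheme.preimage_hsStratum_of_isOpenImmersion j N ν]
  ext z
  simp only [Set.mem_preimage, Set.mem_singleton_iff]
  constructor
  · intro hz
    have hz' : j.base z ∈ Set.range j.base ∩ Scheme.hsStratum W N ν := ⟨⟨z, rfl⟩, hz⟩
    rw [h] at hz'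
    exact j.isOpenEmbedding.injective hz'
  · intro hz
    rw [hz]
    have hy : j.base y ∈ Set.range j.base ∩ Scheme.hsStratum W N ν := by rw [h]; exact Set.mem_singleton _
    exact hy.2

/-- The `Opens` form: for an open `U ∋ w` of `W` with `U ∩ W(ν) = {w}`, the open subscheme `U` is pointed at `w`. [folklore] -/
theorem qPointed_opens_of_inter_eq {W : Scheme.{u}} [IsLocallyNoetherian W] (U : W.Opens) {w : W} (hw : w ∈ U)
    (h : (U : Set W) ∩ Scheme.hsStratum W N ν = {w}) : QPointed N ν (U : Scheme.{u}) (⟨w, hw⟩ : U) :=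
  qPointed_of_isOpenImmersion U.ι (by rw [Scheme.Opens.range_ι]; exact h)

/-- The `Opens` form of §2: a maximal origin restricts to every open `U ∋ w`. [folklore] -/
theorem IsMaximalOrigin.opens {W : Scheme.{u}} [IsLocallyNoetherian W] {w : W} (hW : IsMaximalOrigin p N ν W w)
    (U : W.Opens) (hw : w ∈ U) : IsMaximalOrigin p N ν (U : Scheme.{u}) (⟨w, hw⟩ : U) :=
  IsMaximalOrigin.of_isOpenImmersion U.ι (y := (⟨w, hw⟩ : U)) hW

/-! ## §3. At a maximal origin, isolation in `W_max` is isolation in `W(ν)` -/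

/-- At a maximal origin the `ν`-stratum lies in the Hilbert–Samuel locus `W_max`. [cite: CossartJannsenSaito2020, Def. 2.35] -/
theorem IsMaximalOrigin.hsStratum_subset_hsMaxLocus {W : Scheme.{u}} {w : W} (hW : IsMaximalOrigin p N ν W w) :
    Scheme.hsStratum W N ν ⊆ Scheme.hsMaxLocus W N := by
  intro v hv
  rw [Scheme.mem_hsMaxLocus_iff, Scheme.mem_hsStratum_iff.mp hv]
  exact hW.maximal

/-- **At a maximal origin, a point isolated in `W_max` (CJS Def. 13.3) is isolated in its stratum**: some open `U ∋ w` has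
`U ∩ W(ν) = {w}`. [cite: CossartJannsenSaito2020, Def. 13.3, Def. 2.35] -/
theorem IsMaximalOrigin.exists_isOpen_inter_hsStratum_eq {W : Scheme.{u}} [IsLocallyNoetherian W] {w : W}
    (hW : IsMaximalOrigin p N ν W w) (hiso : IsIsolatedInHSMaxLocus W N w) :
    ∃ U : Set W, IsOpen U ∧ w ∈ U ∧ U ∩ Scheme.hsStratum W N ν = {w} := by
  obtain ⟨U, hU, hUmax⟩ := hiso
  have hwU : w ∈ U := by
    have : w ∈ U ∩ Scheme.hsMaxLocus W N := by rw [hUmax]; exact Set.mem_singleton _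
    exact this.1
  refine ⟨U, hU, hwU, Set.Subset.antisymm ?_ ?_⟩
  · rintro v ⟨hvU, hvν⟩
    have : v ∈ U ∩ Scheme.hsMaxLocus W N := ⟨hvU, hW.hsStratum_subset_hsMaxLocus hvν⟩
    rwa [hUmax] at this
  · rintro v rfl
    exact ⟨hwU, hW.mem_stratum⟩

/-! ## §4. The pointed restart data at an isolated stage -/

/-- **POINTED RESTART DATA at a maximal origin isolated in `W_max`**: there is an open `U ∋ w` of `W` with `U ∩ W(ν) = {w}`, and
for every such open the open subscheme `(U, w)` is a POINTED MAXIMAL ORIGIN for the same `(p, N, ν)`: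
`IsMaximalOrigin p N ν U w ∧ QPointed N ν U w`. [cite: CossartJannsenSaito2020, Def. 13.3, Rem. 6.29 (1)] -/
theorem IsMaximalOrigin.exists_opens_pointed_of_isIsolatedInHSMaxLocus {W : Scheme.{u}} [IsLocallyNoetherian W] {w : W}
    (hW : IsMaximalOrigin p N ν W w) (hiso : IsIsolatedInHSMaxLocus W N w) :
    ∃ (U : W.Opens) (hw : w ∈ U), (U : Set W) ∩ Scheme.hsStratum W N ν = {w} ∧
      IsMaximalOrigin p N ν (U : Scheme.{u}) (⟨w, hw⟩ : U) ∧ QPointed N ν (U : Scheme.{u}) (⟨w, hw⟩ : U) := by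
  obtain ⟨U, hU, hwU, hUν⟩ := hW.exists_isOpen_inter_hsStratum_eq hiso
  exact ⟨⟨U, hU⟩, hwU, hUν, hW.opens ⟨U, hU⟩ hwU, qPointed_opens_of_inter_eq ⟨U, hU⟩ hwU hUν⟩

/-- **POINTED RESTART DATA AT AN ISOLATED REACHED STAGE** (the origin data of `IsoOpenRestartM`'s conclusion and of the base of
`IsoTailTowerExtractionM`'s tower): at a stage `s` reached from a maximal origin (admissible oracle) whose marked point is isolated
in the Hilbert–Samuel locus (`Moving.Iso N s`), some open `U ∋ x_s` of `X_s` has `U ∩ X_s(ν) = {x_s}`, and `(U, x_s)` is a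
pointed maximal origin: `IsMaximalOrigin p N ν U x_s ∧ QPointed N ν U x_s`. [cite: CossartJannsenSaito2020, Def. 13.3, Rem. 6.29 (1)] -/
theorem IsMaximalOrigin.exists_opens_pointed_of_iso (hRa : OracleAdmissible R) {X : Scheme.{u}} [IsLocallyNoetherian X]
    {x : X} (hX : IsMaximalOrigin p N ν X x) {s : MarkedStage.{u}} (hs : Reaches R N ν (MarkedStage.init X x) s)
    (hiso : Moving.Iso N s) :
    ∃ (U : s.W.Opens) (h : s.pt ∈ U), (U : Set s.W) ∩ @Scheme.hsStratum s.W N ν = {s.pt} ∧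
      IsMaximalOrigin p N ν (U : Scheme.{u}) (⟨s.pt, h⟩ : U) ∧ QPointed N ν (U : Scheme.{u}) (⟨s.pt, h⟩ : U) := by
  haveI : IsLocallyNoetherian s.W := s.ln
  exact (hX.of_reaches hRa hs).exists_opens_pointed_of_isIsolatedInHSMaxLocus hiso

/-- The `Set`-level form at a reached isolated stage: an open `U ∋ x_s` of `X_s` with `U ∩ X_s(ν) = {x_s}` (no `StateGood`, no
`ν ≠ Φ^{(N)}` hypothesis; compare `stratumIsolated_of_iso`). [cite: CossartJannsenSaito2020, Def. 13.3] -/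
theorem IsMaximalOrigin.exists_isOpen_inter_hsStratum_eq_of_iso (hRa : OracleAdmissible R) {X : Scheme.{u}}
    [IsLocallyNoetherian X] {x : X} (hX : IsMaximalOrigin p N ν X x) {s : MarkedStage.{u}}
    (hs : Reaches R N ν (MarkedStage.init X x) s) (hiso : Moving.Iso N s) :
    ∃ U : Set s.W, IsOpen U ∧ s.pt ∈ U ∧ U ∩ @Scheme.hsStratum s.W N ν = {s.pt} := by
  haveI : IsLocallyNoetherian s.W := s.ln
  exact (hX.of_reaches hRa hs).exists_isOpen_inter_hsStratum_eq hiso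

/-- **PACKAGED FOR THE RESTART ROW** (`IsoOpenRestartM`'s first conjuncts, with the local-noetherianity witness the row's
`MarkedStage.init U hU y` takes): at a reached isolated stage, an open `U ∋ x_s` with `U ∩ X_s(ν) = {x_s}`, a witness
`hU : IsLocallyNoetherian U`, and `IsMaximalOrigin p N ν U x_s ∧ QPointed N ν U x_s`. [cite: CossartJannsenSaito2020, Def. 13.3, Rem. 6.29 (1)] -/
theorem IsMaximalOrigin.exists_pointed_origin_of_iso (hRa : OracleAdmissible R) {X : Scheme.{u}} [IsLocallyNoetherian X]
    {x : X} (hX : IsMaximalOrigin p N ν X x) {s : MarkedStage.{u}} (hs : Reaches R N ν (MarkedStage.init X x) s)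
    (hiso : Moving.Iso N s) :
    ∃ (U : s.W.Opens) (h : s.pt ∈ U) (_ : IsLocallyNoetherian (U : Scheme.{u})),
      (U : Set s.W) ∩ @Scheme.hsStratum s.W N ν = {s.pt} ∧
      IsMaximalOrigin p N ν (U : Scheme.{u}) (⟨s.pt, h⟩ : U) ∧ QPointed N ν (U : Scheme.{u}) (⟨s.pt, h⟩ : U) := by
  haveI : IsLocallyNoetherian s.W := s.ln
  obtain ⟨U, h, hUν, hmax, hpt⟩ := hX.exists_opens_pointed_of_iso hRa hs hiso
  exact ⟨U, h, isLocallyNoetherian_of_isOpenImmersion U.ι, hUν, hmax, hpt⟩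

/-! ## §5. Isolation in the Hilbert–Samuel locus passes to and from open subschemes at a maximal origin

(the brick `Moving.Iso.of_isOpenImmersion` asked for by D8, res-D-pv-060 08:03:14Z: along the open immersions `ι m` of a run-level
Zariski localisation, `Iso` is read on either side). From the open to the ambient scheme no hypothesis is needed beyond locality of
`H^N`; from the ambient scheme to the open one uses that `H^N ≤ ν` near a point of the MAXIMAL stratum `W(ν)` (finitely many values and
closed `W(≥ μ)` on a scheme of finite type over a field, CJS Lemma 2.36 / Thm. 2.33), so that near such a point `W_max = W(ν)`. -/

/-- **Upper semicontinuity at a maximal origin**: some open `V ∋ w` has `H^N_W ≤ ν` on `V` (`W` is of finite type over a field with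
`dim W ≤ N`: finitely many values, tree `Scheme.finite_hsValues_of_isExcellent`, and every `W(≥ μ)` closed, `isClosed_hsStratumGE_over_field`;
remove the finitely many closed `W(≥ μ)`, `μ ≰ ν`). [cite: CossartJannsenSaito2020, Thm. 2.33, Lemma 2.36] -/
theorem IsMaximalOrigin.exists_isOpen_forall_hsFun_le {W : Scheme.{u}} [IsLocallyNoetherian W] {w : W}
    (hW : IsMaximalOrigin p N ν W w) : ∃ V : Set W, IsOpen V ∧ w ∈ V ∧ ∀ v ∈ V, Scheme.hsFun W N v ≤ ν := by
  obtain ⟨k, _, _, f, -, hft, hqc⟩ := hW.exists_structure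
  haveI := hft
  haveI := hqc
  haveI : IsNoetherian W := Scheme.isNoetherian_of_finiteType_over_field f
  have hfin : (Scheme.hsValues W N).Finite :=
    Scheme.finite_hsValues_of_isExcellent (Scheme.isExcellent_of_locallyOfFiniteType Stacks07QW_field_holds f) N
      (hsPsi_le_of_dim_le' hW.dim_le)
  let S : Set (ℕ → ℕ) := {μ | μ ∈ Scheme.hsValues W N ∧ ¬ μ ≤ ν}
  have hS : S.Finite := hfin.subset fun μ hμ => hμ.1
  refine ⟨(⋃ μ ∈ S, Scheme.hsStratumGE W N μ)ᶜ, ?_, ?_, ?_⟩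
  · exact (hS.isClosed_biUnion fun μ _ => isClosed_hsStratumGE_over_field f hW.dim_le μ).isOpen_compl
  · simp only [Set.mem_compl_iff, Set.mem_iUnion, Scheme.mem_hsStratumGE_iff, not_exists]
    intro μ hμ hle
    exact hμ.2 (hle.trans_eq hW.mem_stratum)
  · intro v hv
    simp only [Set.mem_compl_iff, Set.mem_iUnion, Scheme.mem_hsStratumGE_iff, not_exists] at hv
    by_contra hle
    exact hv (Scheme.hsFun W N v) ⟨⟨v, rfl⟩, hle⟩ le_rfl

/-- **Near a point of a maximal stratum, `W_max = W(ν)`**: on an open `V ∋ w` with `H^N ≤ ν`, a point of the Hilbert–Samuel locus lies in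
`W(ν)` (and conversely everywhere, `hsStratum_subset_hsMaxLocus`). [cite: CossartJannsenSaito2020, Def. 2.35] -/
theorem IsMaximalOrigin.exists_isOpen_hsMaxLocus_inter_eq {W : Scheme.{u}} [IsLocallyNoetherian W] {w : W}
    (hW : IsMaximalOrigin p N ν W w) :
    ∃ V : Set W, IsOpen V ∧ w ∈ V ∧ V ∩ Scheme.hsMaxLocus W N = V ∩ Scheme.hsStratum W N ν := by
  obtain ⟨V, hV, hwV, hle⟩ := hW.exists_isOpen_forall_hsFun_le
  refine ⟨V, hV, hwV, Set.Subset.antisymm ?_ fun v hv => ⟨hv.1, hW.hsStratum_subset_hsMaxLocus hv.2⟩⟩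
  rintro v ⟨hvV, hvmax⟩
  refine ⟨hvV, Scheme.mem_hsStratum_iff.mpr (le_antisymm (hle v hvV) ?_)⟩
  exact (Scheme.mem_hsMaxLocus_iff.mp hvmax).2 ⟨w, hW.mem_stratum⟩ (hle v hvV)

/-- **Isolation in the Hilbert–Samuel locus ASCENDS along an open immersion** (no maximality needed on the nose beyond the origin data:
`Σ_U ⊆ Σ_W`, so a point of `U` whose image is in `W_max` is in `U_max`). [cite: CossartJannsenSaito2020, Def. 13.3, Def. 2.35] -/
theorem isIsolatedInHSMaxLocus_of_isOpenImmersion_of_isIsolatedInHSMaxLocus {U W : Scheme.{u}} [IsLocallyNoetherian U]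
    [IsLocallyNoetherian W] (j : U ⟶ W) [IsOpenImmersion j] {y : U} (hy : j.base y ∈ Scheme.hsMaxLocus W N)
    (hiso : IsIsolatedInHSMaxLocus U N y) : IsIsolatedInHSMaxLocus W N (j.base y) := by
  obtain ⟨U₀, hU₀, hU₀max⟩ := hiso
  refine ⟨j.base '' U₀, j.isOpenEmbedding.isOpenMap _ hU₀, Set.Subset.antisymm ?_ ?_⟩
  · rintro _ ⟨⟨z, hz, rfl⟩, hzmax⟩
    have hz' : z ∈ U₀ ∩ Scheme.hsMaxLocus U N := by
      refine ⟨hz, Scheme.mem_hsMaxLocus_iff.mpr ?_⟩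
      rw [Scheme.hsFun_eq_of_isOpenImmersion j N z]
      obtain ⟨-, hmax⟩ := Scheme.mem_hsMaxLocus_iff.mp hzmax
      exact ⟨⟨z, (Scheme.hsFun_eq_of_isOpenImmersion j N z)⟩,
        fun μ hμ hle => hmax (Scheme.hsValues_subset_of_isOpenImmersion j N hμ) hle⟩
    rw [hU₀max] at hz'
    rw [Set.mem_singleton_iff.mp hz']
    rfl
  · rintro _ rfl
    have hy₀ : y ∈ U₀ ∩ Scheme.hsMaxLocus U N := by rw [hU₀max]; exact Set.mem_singleton _
    exact ⟨⟨y, hy₀.1, rfl⟩, hy⟩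

/-- **Isolation in the Hilbert–Samuel locus DESCENDS to an open subscheme through a point of a MAXIMAL stratum**: for an open immersion
`j : U ⟶ W` and a maximal origin `(W, j y)` isolated in `W_max`, the point `y` is isolated in `U_max` (near `j y`, `W_max = W(ν)`;
strata pull back; `Σ_U ⊆ Σ_W`). [cite: CossartJannsenSaito2020, Def. 13.3, Def. 2.35, Lemma 2.36] -/
theorem IsMaximalOrigin.isIsolatedInHSMaxLocus_of_isOpenImmersion {U W : Scheme.{u}} [IsLocallyNoetherian U]
    [IsLocallyNoetherian W] (j : U ⟶ W) [IsOpenImmersion j] {y : U} (hW : IsMaximalOrigin p N ν W (j.base y))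
    (hiso : IsIsolatedInHSMaxLocus W N (j.base y)) : IsIsolatedInHSMaxLocus U N y := by
  obtain ⟨U₀, hU₀, hy₀, hU₀ν⟩ := hW.exists_isOpen_inter_hsStratum_eq hiso
  obtain ⟨V, hV, hyV, hVle⟩ := hW.exists_isOpen_forall_hsFun_le
  have hU := hW.of_isOpenImmersion j
  refine ⟨j.base ⁻¹' (U₀ ∩ V), (hU₀.inter hV).preimage j.continuous, Set.Subset.antisymm ?_ ?_⟩
  · rintro z ⟨⟨hzU₀, hzV⟩, hzmax⟩
    -- `H_U(z) = H_W(j z) ≤ ν` and `H_U(z)` is maximal among the values of `U`, one of which is `ν`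
    have hzν : Scheme.hsFun W N (j.base z) = ν := by
      refine le_antisymm (hVle _ hzV) ?_
      have h := (Scheme.mem_hsMaxLocus_iff.mp hzmax).2 ⟨y, hU.mem_stratum⟩
      rw [Scheme.hsFun_eq_of_isOpenImmersion j N z] at h
      exact h (hVle _ hzV)
    have : j.base z ∈ U₀ ∩ Scheme.hsStratum W N ν := ⟨hzU₀, hzν⟩
    rw [hU₀ν] at this
    exact j.isOpenEmbedding.injective this
  · rintro z rfl
    exact ⟨⟨hy₀, hyV⟩, hU.hsStratum_subset_hsMaxLocus hU.mem_stratum⟩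

/-- **`IsIsolatedInHSMaxLocus` is read on either side of an open immersion through a point of a maximal stratum.**
[cite: CossartJannsenSaito2020, Def. 13.3] -/
theorem IsMaximalOrigin.isIsolatedInHSMaxLocus_iff_of_isOpenImmersion {U W : Scheme.{u}} [IsLocallyNoetherian U]
    [IsLocallyNoetherian W] (j : U ⟶ W) [IsOpenImmersion j] {y : U} (hW : IsMaximalOrigin p N ν W (j.base y)) :
    IsIsolatedInHSMaxLocus U N y ↔ IsIsolatedInHSMaxLocus W N (j.base y) :=
  ⟨isIsolatedInHSMaxLocus_of_isOpenImmersion_of_isIsolatedInHSMaxLocus j (hW.hsStratum_subset_hsMaxLocus hW.mem_stratum),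
    hW.isIsolatedInHSMaxLocus_of_isOpenImmersion j⟩

/-- **`Moving.Iso` ALONG AN OPEN IMMERSION OF MARKED STAGES** (D8's brick): if `ι : s'.W ⟶ s.W` is an open immersion with
`ι x' = x`, and `(X_s, x)` is a maximal origin for `(p, N, ν)` (e.g. `s` reached from one, `IsMaximalOrigin.of_reaches`), then
`Moving.Iso N s → Moving.Iso N s'`. [cite: CossartJannsenSaito2020, Def. 13.3] -/
theorem _root_.Summit.ResolutionOfSingularities.ResolutionOfSingularities.Theorems.SigmaMaxModificationsCorridor3.Moving.Iso.of_isOpenImmersion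
    {s s' : MarkedStage.{u}} (ι : s'.W ⟶ s.W) [IsOpenImmersion ι] (hpt : ι.base s'.pt = s.pt)
    (hs : IsMaximalOrigin p N ν s.W s.pt) (hiso : Moving.Iso N s) : Moving.Iso N s' := by
  letI := s.ln
  letI := s'.ln
  have hiso' : IsIsolatedInHSMaxLocus s.W N s.pt := hiso
  rw [← hpt] at hs hiso'
  exact (hs.isIsolatedInHSMaxLocus_of_isOpenImmersion ι hiso' : IsIsolatedInHSMaxLocus s'.W N s'.pt)

/-- … and conversely `Moving.Iso N s' → Moving.Iso N s` (only `x ∈ (X_s)_max` is used). [cite: CossartJannsenSaito2020, Def. 13.3] -/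
theorem _root_.Summit.ResolutionOfSingularities.ResolutionOfSingularities.Theorems.SigmaMaxModificationsCorridor3.Moving.Iso.to_isOpenImmersion
    {s s' : MarkedStage.{u}} (ι : s'.W ⟶ s.W) [IsOpenImmersion ι] (hpt : ι.base s'.pt = s.pt)
    (hs : IsMaximalOrigin p N ν s.W s.pt) (hiso : Moving.Iso N s') : Moving.Iso N s := by
  letI := s.ln
  letI := s'.ln
  show IsIsolatedInHSMaxLocus s.W N s.pt
  rw [← hpt] at hs ⊢
  exact isIsolatedInHSMaxLocus_of_isOpenImmersion_of_isIsolatedInHSMaxLocus ι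
    (hs.hsStratum_subset_hsMaxLocus hs.mem_stratum) (hiso : IsIsolatedInHSMaxLocus s'.W N s'.pt)

/-- The `iff` at marked stages. [cite: CossartJannsenSaito2020, Def. 13.3] -/
theorem _root_.Summit.ResolutionOfSingularities.ResolutionOfSingularities.Theorems.SigmaMaxModificationsCorridor3.Moving.iso_iff_of_isOpenImmersion
    {s s' : MarkedStage.{u}} (ι : s'.W ⟶ s.W) [IsOpenImmersion ι] (hpt : ι.base s'.pt = s.pt)
    (hs : IsMaximalOrigin p N ν s.W s.pt) : Moving.Iso N s' ↔ Moving.Iso N s :=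
  ⟨Moving.Iso.to_isOpenImmersion ι hpt hs, Moving.Iso.of_isOpenImmersion ι hpt hs⟩

/-- **Both marked stages of an open immersion through the marked points, reached from maximal origins with the same `(p, N, ν)`**
(D8's spelling `Moving.Iso.of_isOpenImmersion_of_reaches`): `Moving.Iso N s → Moving.Iso N s'`. [cite: CossartJannsenSaito2020, Def. 13.3] -/
theorem _root_.Summit.ResolutionOfSingularities.ResolutionOfSingularities.Theorems.SigmaMaxModificationsCorridor3.Moving.Iso.of_isOpenImmersion_of_reaches
    (hRa : OracleAdmissible R) {X : Scheme.{u}} [IsLocallyNoetherian X] {x : X} (hX : IsMaximalOrigin p N ν X x)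
    {s s' : MarkedStage.{u}} (hs : Reaches R N ν (MarkedStage.init X x) s) (ι : s'.W ⟶ s.W) [IsOpenImmersion ι]
    (hpt : ι.base s'.pt = s.pt) (hiso : Moving.Iso N s) : Moving.Iso N s' :=
  Moving.Iso.of_isOpenImmersion ι hpt (hX.of_reaches hRa hs) hiso

end CampaignW42

end Summit.ResolutionOfSingularities.ResolutionOfSingularities.Theorems

end
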